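import Literature.Geometry.Symplectic.OrigamiForm
import Literature.Topology.FourManifolds.SmoothOrientation
import HarnessLib

/-!
# Unfolding (symplectic cutting) of an origami 4-manifold — named fact

A. Cannas da Silva, V. Guillemin, A. R. Pires, *Symplectic Origami*, IMRN 2011 (18) 4252–4293 =
arXiv:0909.4065 [`CannasdasilvaGuilleminPires2010`], §2.2–2.5 (read, pp. 5–11 of the arXiv text).
Companion to `OrigamiForm.lean` (`IsOrigamiForm`, Def. 2.1/2.2), whose module docstring defers
exactly this: "Not here either: the unfolding / folding correspondence (Prop. 2.8, Thm. 2.26), to be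
vendored as a named fact once the route's fold-data carriers are fixed."  The carriers are now the
`Fin 2`-indexed fold data of the route `SmoothPoincare4/SymplecticOrigami` (items `OrigamiRung`,
`OrigamiFoldExistence`, bridge item `OrigamiUnfolding`), and this file states the theorem over them.

## The printed statements

* **Prop. 2.8** [= Cannas da Silva–Guillemin–Woodward 2000, Thm. 7]: "Let `(M²ⁿ, ω)` be an oriented
  origami manifold with null fibration `S¹ ↪ Z → B`. Then the unions `M⁺ ⊔ B` and `M⁻ ⊔ B` each
  naturally admits a structure of `2n`-dimensional symplectic manifold, denoted `(M₀⁺, ω₀⁺)` and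
  `(M₀⁻, ω₀⁻)` respectively, with `ω₀⁺` and `ω₀⁻` restricting to `ω` on `M⁺` and `M⁻` and with a
  natural embedding of `(B, ω_B)` as a symplectic submanifold with projectivised normal bundle
  isomorphic to `Z → B`."  Here (§2.1) for oriented `M` "the complement `M ∖ Z` decomposes into open
  subsets `M⁺` where `ωⁿ > 0` and `M⁻` where `ωⁿ < 0`", and (after Def. 2.11) "when the original
  origami manifold is compact, the symplectic cut space is also compact".  The proof glues the
  reduced space `μ⁻¹(0)/S¹` of the cut to `M^±` along the symplectomorphisms
  `j^± : 𝒰^± → μ⁻¹(0)/S¹`, `φ(x, ±√s) ↦ [x, s, ±√(2s)]`, where `φ : Z × (-ε, ε) → 𝒰` is a Moser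
  collar of the fold with `φ*ω = p*i*ω + d(t² p*α)`.
* **Def. 2.13** (blow-up model `β : 𝒩 × (-ε, ε) → 𝒰` of a neighbourhood of a codimension-two
  symplectic submanifold `B` with projectivised normal bundle `𝒩`), properties: "(1) the
  restriction of `β` to `𝒩 × (0, ε)` is an orientation-preserving diffeomorphism onto `𝒰 ∖ B`;
  (3) the restriction of `β` to `𝒩 × {0}` is the bundle projection `𝒩 → B`; (4) for the vector
  fields `ν` generating the vertical bundle of `𝒩 → B` and `∂/∂t` … `Dβ(ν)` intersects zero
  transversally and `Dβ(∂/∂t)` is never zero."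
* **Proof of Prop. 2.26**: under the bundle isomorphism `𝒩 ≅ Z` of Prop. 2.8 "we pick the following
  natural blow-up model for the neighborhood `μ⁻¹(0)/S¹` of `B₁` in `(M₁, ω₁)`:
  `β : Z × (-ε, ε) → μ⁻¹(0)/S¹`, `(x, t) ↦ [x, t², t√2]`", with `β*ω₁ = φ*ω` and the commuting
  triangles `j^± ∘ φ = β` on `Z × (0, ε)`, resp. `Z × (-ε, 0)`.

Consequently the symplectomorphism `j̄⁺ : M⁺ → M₀⁺ ∖ B` (and likewise `j̄⁻`) extends, by `β ∘ φ⁻¹`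
on the whole collar `𝒰`, to a smooth map on the open neighbourhood `M^± ∪ 𝒰` of the closure
`M^± ∪ Z`, which maps `Z` onto the centre `B` as the bundle projection and whose differential at a
fold point has kernel exactly the null (fibre) line.  This is the "blow-down map" of the route's
fold data.

## Rendering (`n = 2`) and wording risks

* `M` is a compact connected `C^∞` 4-manifold (`T2`, second countable, model `𝓡 4`) which is
  orientable (`Literature.Topology.FourManifolds.IsOrientable (𝓡 4) M`); `so` is an origami form in
  the sense of the tree's `IsOrigamiForm` (compact embedded folding hypersurface and FREE smooth null
  circle action as existential data) with CONNECTED (hence non-empty) fold `fold so`.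
* The tree's `IsOrigamiForm` does not impose the orientation-matching convention of Def. 2.2 ("when
  `M` is oriented, we assume that the principal `S¹`-action matches the induced orientation of the
  null foliation"); for a connected fold either the given free action or its inverse `a ↦ θ a⁻¹`
  matches, and the cut pieces do not depend on the choice of principal action (discussion after
  Def. 2.5), so the printed theorem covers the rendering.
* Conclusion = the route's fold data with, in addition, the symplectomorphism clause
  (`(β i)^* (s i) = so` on `V i`) and the fold mapped ONTO the centre: disjoint non-empty open
  `V 0, V 1` (`M⁺, M⁻`) with `(V 0 ∪ V 1)ᶜ = fold so`; closed connected symplectic `(N i, s i)`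
  (`(M₀^±, ω₀^±)`); compact connected surfaces `S i` embedded by `b i` with `s i`-symplectic image
  (the centre `B`, compact and connected as the base of the circle bundle `Z → B` over the compact
  connected fold); `β i : M → N i` smooth on an open set containing `closure (V i)`, injective with
  invertible differential on `V i`, `β i '' V i = (range (b i))ᶜ`, `β i '' fold so = range (b i)`,
  `dim ker d(β i) = 1` on the fold.  Connectedness of `M₀^±`: `M` and `Z` connected force `M⁺`, `M⁻`
  connected (each component of `M ∖ Z` contains one of the two halves of the collar), and `M^±` is
  dense in `M₀^±`.  `T2`/second countability of the pieces are part of "manifold".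
* Orientability cannot be dropped: `(ℝℙ⁴, ω₀)` (Example 2.4) is a compact origami manifold with
  connected, non-coorientable fold and connected `M ∖ Z` (one cut piece, Example 2.7).

Nothing is asserted; users take `(h : exists_symplecticCutPieces_of_isOrigamiForm)`.  Not here: the
converse folding construction (radial blow-up, Prop. 2.17 / Def. 2.18) and the uniqueness half of
Prop. 2.26.

## References

* [CannasdasilvaGuilleminPires2010] A. Cannas da Silva, V. Guillemin, A. R. Pires, *Symplectic
  Origami*, IMRN 2011, 4252–4293, doi:10.1093/imrn/rnq241 = arXiv:0909.4065, Prop. 2.8, Def. 2.13,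
  Lemma 2.14, Prop. 2.26.
* A. Cannas da Silva, V. Guillemin, C. Woodward, *On the unfolding of folded symplectic structures*,
  Math. Res. Lett. 7 (2000) 35–53, Thm. 7.
-/

noncomputable section

open scoped Manifold ContDiff
open Literature.Geometry.Kaehler

namespace Literature.Geometry.Symplectic

universe u

/-- **Unfolding (symplectic cutting) of a compact oriented origami 4-manifold with connected fold**
(Cannas da Silva–Guillemin–Pires 2010, Prop. 2.8 [= Cannas da Silva–Guillemin–Woodward 2000,
Thm. 7], with the blow-up model of Def. 2.13 as chosen in the proof of Prop. 2.26), NAMED FACT.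
Prop. 2.8: "Let `(M²ⁿ, ω)` be an oriented origami manifold with null fibration `S¹ ↪ Z → B`. Then
the unions `M⁺ ⊔ B` and `M⁻ ⊔ B` each naturally admits a structure of `2n`-dimensional symplectic
manifold, denoted `(M₀⁺, ω₀⁺)` and `(M₀⁻, ω₀⁻)` respectively, with `ω₀^±` restricting to `ω` on
`M^±` and with a natural embedding of `(B, ω_B)` as a symplectic submanifold with projectivised
normal bundle isomorphic to `Z → B`" (compact when `M` is, after Def. 2.11); proof of Prop. 2.26
with Def. 2.13 (1), (3), (4): the symplectomorphisms `M^± → M₀^± ∖ B` extend over a Moser collar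
`φ : Z × (-ε, ε) → 𝒰` of the fold by the blow-up model `φ (x, t) ↦ [x, t², t√2]`, smooth into
`M₀^±`, restricting on `Z` to the bundle projection onto the centre `B`, with differential along `Z`
killing exactly the fibre direction.
Rendering for `n = 2` over the tree's `IsOrigamiForm` (see the module docstring for the wording
risks: orientation convention of the circle action, connectedness of the pieces): for a compact
connected orientable 4-manifold `M` and an origami form `so` with connected fold there are, for the
two sides `i : Fin 2`, disjoint non-empty open `V i` with `(V 0 ∪ V 1)ᶜ = fold so`, closed
connected symplectic 4-manifolds `(N i, s i)`, compact connected surfaces `S i` smoothly embedded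
by `b i` with `s i`-symplectic image, and maps `β i : M → N i`, smooth near `closure (V i)`,
restricting on `V i` to a diffeomorphism onto `N i ∖ range (b i)` that pulls `s i` back to `so`,
mapping `fold so` onto `range (b i)` with one-dimensional kernel of `d(β i)` at every fold point.
[cite: CannasdasilvaGuilleminPires2010, Prop. 2.8 with Def. 2.13 and proof of Prop. 2.26] -/
def exists_symplecticCutPieces_of_isOrigamiForm : Prop :=
  ∀ (M : Type u) [TopologicalSpace M] [T2Space M] [SecondCountableTopology M]
    [ChartedSpace (EuclideanSpace ℝ (Fin 4)) M] [IsManifold (𝓡 4) ∞ M]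
    [CompactSpace M] [ConnectedSpace M],
    Literature.Topology.FourManifolds.IsOrientable (𝓡 4) M →
    ∀ (so : MForm (𝓡 4) M ℝ 2), IsOrigamiForm so → IsConnected (fold so) →
    ∃ (V : Fin 2 → TopologicalSpace.Opens M) (N : Fin 2 → Type u)
      (_ : ∀ i, TopologicalSpace (N i)) (_ : ∀ i, T2Space (N i))
      (_ : ∀ i, SecondCountableTopology (N i)) (_ : ∀ i, CompactSpace (N i))
      (_ : ∀ i, ConnectedSpace (N i)) (_ : ∀ i, ChartedSpace (EuclideanSpace ℝ (Fin 4)) (N i))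
      (_ : ∀ i, IsManifold (𝓡 4) ∞ (N i))
      (s : ∀ i, MForm (𝓡 4) (N i) ℝ 2)
      (S : Fin 2 → Type u) (_ : ∀ i, TopologicalSpace (S i)) (_ : ∀ i, CompactSpace (S i))
      (_ : ∀ i, ConnectedSpace (S i)) (_ : ∀ i, ChartedSpace (EuclideanSpace ℝ (Fin 2)) (S i))
      (_ : ∀ i, IsManifold (𝓡 2) ∞ (S i))
      (b : ∀ i, S i → N i) (β : ∀ i, M → N i),
      (Disjoint (V 0) (V 1) ∧ (∀ i, (V i : Set M).Nonempty) ∧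
        ((V 0 : Set M) ∪ (V 1 : Set M))ᶜ = fold so) ∧
      (∀ i, IsSmoothForm (s i) ∧ IsClosedForm (s i) ∧
        (∀ x (v : TangentSpace (𝓡 4) x), v ≠ 0 → ∃ w, s i x ![v, w] ≠ 0) ∧
        Manifold.IsSmoothEmbedding (𝓡 2) (𝓡 4) ∞ (b i) ∧
        (∀ y (v : TangentSpace (𝓡 2) y), v ≠ 0 → ∃ w : TangentSpace (𝓡 2) y,
          s i (b i y) ![mfderiv (𝓡 2) (𝓡 4) (b i) y v, mfderiv (𝓡 2) (𝓡 4) (b i) y w] ≠ 0) ∧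
        (∃ U : Set M, IsOpen U ∧ closure (V i : Set M) ⊆ U ∧
          ContMDiffOn (𝓡 4) (𝓡 4) ∞ (β i) U) ∧
        Set.InjOn (β i) (V i : Set M) ∧ β i '' (V i : Set M) = (Set.range (b i))ᶜ ∧
        (∀ x ∈ (V i : Set M), Function.Bijective (mfderiv (𝓡 4) (𝓡 4) (β i) x)) ∧
        (∀ x ∈ (V i : Set M), ∀ v w : TangentSpace (𝓡 4) x,
          s i (β i x) ![mfderiv (𝓡 4) (𝓡 4) (β i) x v, mfderiv (𝓡 4) (𝓡 4) (β i) x w] =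
            so x ![v, w]) ∧
        β i '' fold so = Set.range (b i) ∧
        (∀ x ∈ fold so,
          Module.finrank ℝ (LinearMap.ker (mfderiv (𝓡 4) (𝓡 4) (β i) x).toLinearMap) = 1))

end Literature.Geometry.Symplectic

end
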